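import Mathlib
import Summits.NavierStokesRegularity.NavierStokesRegularity.Theorems.FilamentSkeletonRssSkeletonEquilibriumBiotSavartDifferentiable
import Summits.NavierStokesRegularity.NavierStokesRegularity.Theorems.FilamentSkeletonRssSelectionBoxRJRungPartnerClose
import Summits.NavierStokesRegularity.NavierStokesRegularity.Theorems.FilamentSkeletonRssSelectionBoxRJRungModelArcConstants

/-!
# Route `FilamentSkeletonRss` · crux `SelectionBoxRJ` (stmt-NavierStokesRegularity-21220) — rung tools (R2, brick 4a):
# the Picard map of the nonlocal rung — tangent fields, the frozen true-partner forcing, and the self-mapping bound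

Lane `ns-filament-19175-p1` (g7); helper file `--supports stmt-NavierStokesRegularity-21220`, route-independent.

The nonlocal rung R2 (true partner field, local-induction self-term) is a fixed point on UNIT TANGENT FIELDS `T : ℝ → ℝ³`:
`T ↦ (x_T)′` where `z_T(t) = P + ∫₀ᵗ T`, `f_T(t) = (Γ·4/(4π))·u[R_π ∘ z_T](z_T t)` is the partner's regularised
Biot–Savart field frozen along `z_T`, and `x_T` solves the cut-off local-induction equation
`x″ = η χ(t) · x′ × (V(x) + f_T(t))`, `x(0) = P`, `x′(0) = e` (`…RungContShooting`).  This file provides the pieces of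
the map that do not compare two tangent fields:

* `tangentCurve_hasDerivAt` / `tangentCurve_contDiff` — `z_T` is `C¹` with `z_T′ = T`, `z_T 0 = P` for continuous `T`;
* `partnerForcing_continuous` — for a `C¹` curve `z` with `‖z′‖ ≤ 1` and radial growth, the partner forcing
  `t ↦ ∫ K(z t − R_π z σ) • ((R_π ∘ z)′ σ × (z t − R_π z σ)) dσ` is continuous (the field is differentiable in the point,
  tree `stub_biotSavartDifferentiable`);
* `cutoff_bending_le` — Γ-uniform bending for the cut-off equation with ANY forcing bounded by `M` on the window
  `|t| ≤ S₂` (`c = 0` beyond, `|c| ≤ η`): `‖x′ t − x′ 0‖ ≤ η((47/10)(‖x 0‖ + S₂) + M)·S₂` on all of `ℝ`, and `x″ = 0`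
  beyond `S₂`;
* `partnerForcing_norm_le` — along a near-straight `R_π`-pair (`θ ≤ 1/500`) the true partner forcing has
  `‖f t‖ ≤ (17/10)√Γ` (`‖U‖ ≤ (8/5)√Γ` plus `28θ√Γ`).

HONEST FRAMING.  Bookkeeping for the rung ladder of a HYPOTHETICAL filament box; nothing here is a claim about Navier–Stokes
regularity or blow-up.
-/

set_option linter.dupNamespace false -- `Theorems.…Theorems`-style path/namespace repetition is the tree convention

noncomputable section

namespace Summit.NavierStokesRegularity.NavierStokesRegularity.Theorems

open Set Function Filter MeasureTheory Real
open Literature.Analysis.FluidPDE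
open Summit.NavierStokesRegularity.NavierStokesRegularity.Theorems.SkeletonEquilibrium.Sketch
open scoped InnerProductSpace Topology

namespace SelectionBoxRJRung

/-! ### Tangent field ↦ curve -/

/-- **The curve of a continuous tangent field.**  For continuous `T`, `z t = P + ∫₀ᵗ T` has `z′ t = T t` everywhere.
[folklore] -/
theorem tangentCurve_hasDerivAt {T : ℝ → EuclideanSpace ℝ (Fin 3)} (hT : Continuous T) (P : EuclideanSpace ℝ (Fin 3))
    (t : ℝ) : HasDerivAt (fun s => P + ∫ u in (0:ℝ)..s, T u) (T t) t := by
  have h := (hT.integral_hasStrictDerivAt 0 t).hasDerivAt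
  exact h.const_add P

/-- The curve of a continuous tangent field is `C¹`, starts at `P`, and has `deriv z = T`. [folklore] -/
theorem tangentCurve_contDiff {T : ℝ → EuclideanSpace ℝ (Fin 3)} (hT : Continuous T) (P : EuclideanSpace ℝ (Fin 3)) :
    ContDiff ℝ 1 (fun s => P + ∫ u in (0:ℝ)..s, T u) ∧ (P + ∫ u in (0:ℝ)..(0:ℝ), T u) = P ∧
      deriv (fun s => P + ∫ u in (0:ℝ)..s, T u) = T := by
  have hd : deriv (fun s => P + ∫ u in (0:ℝ)..s, T u) = T := funext fun t => (tangentCurve_hasDerivAt hT P t).deriv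
  refine ⟨?_, by simp, hd⟩
  rw [contDiff_one_iff_deriv]
  exact ⟨fun t => (tangentCurve_hasDerivAt hT P t).differentiableAt, by rw [hd]; exact hT⟩

/-! ### The frozen true-partner forcing is continuous -/

/-- **Continuity of the partner forcing along a curve.**  Let `z` be `C¹` with `‖z′‖ ≤ 1`, `z 0 = P` and `‖z′ − e‖ ≤ θ`
(`θ ≤ 1/4`, `Γ > 0`).  Then `t ↦ ∫ K(z t − R_π z σ) • ((R_π ∘ z)′ σ × (z t − R_π z σ)) dσ` (core `1`) is continuous: the
field `y ↦ ∫ …` of the `C¹` filament `R_π ∘ z` (radial growth `(1 − θ)|u|`) is differentiable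
(`stub_biotSavartDifferentiable`). [folklore] -/
theorem partnerForcing_continuous {Γ θ : ℝ} (hΓ : 0 < Γ) (hθ1 : θ ≤ 1 / 4)
    {z : ℝ → EuclideanSpace ℝ (Fin 3)} (hz : ContDiff ℝ 1 z) (hunit : ∀ u, ‖deriv z u‖ ≤ 1)
    (hz0 : z 0 = WithLp.toLp 2 ![Real.sqrt Γ / 5, 0, 0])
    (hθ : ∀ s, ‖deriv z s - WithLp.toLp 2 ![0, (Real.sqrt 2)⁻¹, (Real.sqrt 2)⁻¹]‖ ≤ θ) :
    Continuous (fun t => ∫ σ : ℝ,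
      ((‖z t - ((2 * ⟪z σ, EuclideanSpace.single 2 1⟫_ℝ) • (EuclideanSpace.single (2 : Fin 3) (1 : ℝ)) - z σ)‖ ^ 2
          + 1) ^ (3 / 2 : ℝ))⁻¹ •
        cross (deriv (fun u => (2 * ⟪z u, EuclideanSpace.single 2 1⟫_ℝ) •
            (EuclideanSpace.single (2 : Fin 3) (1 : ℝ)) - z u) σ)
          (z t - ((2 * ⟪z σ, EuclideanSpace.single 2 1⟫_ℝ) • (EuclideanSpace.single (2 : Fin 3) (1 : ℝ)) - z σ))) := by
  have hzd : Differentiable ℝ z := hz.differentiable one_ne_zero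
  have hθ0 : 0 ≤ θ := (norm_nonneg _).trans (hθ 0)
  set e₃ : EuclideanSpace ℝ (Fin 3) := EuclideanSpace.single (2 : Fin 3) (1 : ℝ) with he₃
  set L : EuclideanSpace ℝ (Fin 3) →L[ℝ] EuclideanSpace ℝ (Fin 3) :=
    (2 : ℝ) • (innerSL ℝ e₃).smulRight e₃ - ContinuousLinearMap.id ℝ (EuclideanSpace ℝ (Fin 3)) with hLdef
  have hL : ∀ y, L y = (2 * ⟪y, e₃⟫_ℝ) • e₃ - y := fun y => by
    simp [hLdef, smul_smul, real_inner_comm]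
  set X : ℝ → EuclideanSpace ℝ (Fin 3) := fun u => (2 * ⟪z u, e₃⟫_ℝ) • e₃ - z u with hXdef
  have hXL : X = fun u => L (z u) := by funext u; rw [hXdef, hL]
  have hXc : ContDiff ℝ 1 X := by rw [hXL]; exact L.contDiff.comp hz
  have hXd : ∀ u, deriv X u = L (deriv z u) := fun u => by
    rw [hXL]; exact (L.hasFDerivAt.comp_hasDerivAt u (hzd u).hasDerivAt).deriv
  have hdX : ∀ u, ‖deriv X u‖ ≤ 1 := fun u => by
    rw [hXd u, hL, norm_rotPi]; exact hunit u
  have hgrow : ∀ u, (1 - θ) * |u| - 0 ≤ ‖X u‖ := fun u => by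
    rw [sub_zero, hXdef]; dsimp only; rw [norm_rotPi]
    exact arc_norm_ge hΓ.le hzd hz0 hθ u
  have hF := stub_biotSavartDifferentiable 1 (1 - θ) 0 X one_ne_zero (by linarith) hXc hdX hgrow
  simp only [one_pow] at hF
  exact hF.continuous.comp hz.continuous

/-! ### Bending for the cut-off equation with a bounded forcing -/

/-- **Γ-uniform bending of a cut-off local-induction arc with ANY bounded forcing.**  Let `x` be `C²` with unit speed,
`x″ t = c t • x′ t × (V(x t) + f t)` (`V y = ½ y − (21/5) e₃ × y`) where `|c t| ≤ η` everywhere, `c t = 0` for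
`S₂ ≤ |t|` (`S₂ > 0`), and `‖f t‖ ≤ M` for `|t| ≤ S₂`.  Then `x″ = 0` beyond `S₂`, `‖x″‖ ≤ η((47/10)(‖x 0‖ + S₂) + M)`
everywhere, and `‖x′ t − x′ 0‖ ≤ η((47/10)(‖x 0‖ + S₂) + M)·S₂` for ALL `t`. [folklore] -/
theorem cutoff_bending_le {η S₂ M : ℝ} {c : ℝ → ℝ} {f x : ℝ → EuclideanSpace ℝ (Fin 3)} (hη : 0 ≤ η) (hS₂ : 0 < S₂)
    (hM : 0 ≤ M) (hx : ContDiff ℝ 2 x) (hunit : ∀ t, ‖deriv x t‖ = 1)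
    (hode : ∀ t, iteratedDeriv 2 x t = c t • cross (deriv x t)
      ((1 / 2 : ℝ) • x t - (21 / 5 : ℝ) • cross (EuclideanSpace.single 2 1) (x t) + f t))
    (hc : ∀ t, |c t| ≤ η) (hc0 : ∀ t, S₂ ≤ |t| → c t = 0) (hf : ∀ t, |t| ≤ S₂ → ‖f t‖ ≤ M) :
    (∀ t, S₂ ≤ |t| → iteratedDeriv 2 x t = 0) ∧
    (∀ t, ‖iteratedDeriv 2 x t‖ ≤ η * ((47 / 10) * (‖x 0‖ + S₂) + M)) ∧
    (∀ t, ‖deriv x t - deriv x 0‖ ≤ η * ((47 / 10) * (‖x 0‖ + S₂) + M) * S₂) := by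
  have hxd : Differentiable ℝ x := hx.differentiable (by norm_num)
  have hTd : Differentiable ℝ (deriv x) := hx.differentiable_deriv_two
  have h2 : iteratedDeriv 2 x = deriv (deriv x) := by rw [iteratedDeriv_succ, iteratedDeriv_one]
  have hM₂0 : 0 ≤ η * ((47 / 10) * (‖x 0‖ + S₂) + M) := by positivity
  have harm : ∀ t, S₂ ≤ |t| → iteratedDeriv 2 x t = 0 := by
    intro t ht; rw [hode t, hc0 t ht, zero_smul]
  have hpos : ∀ s, ‖x s‖ ≤ ‖x 0‖ + |s| := fun s => liaModel_position_bound hxd hunit s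
  have hcurv : ∀ s, ‖iteratedDeriv 2 x s‖ ≤ η * ((47 / 10) * (‖x 0‖ + S₂) + M) := by
    intro s
    rcases le_or_gt S₂ |s| with hs | hs
    · rw [harm s hs, norm_zero]; exact hM₂0
    · have h := liaModel_curvature_bound (c s) (21 / 5) M (deriv x s) (x s) (f s)
        (iteratedDeriv 2 x s) (hunit s) (hf s hs.le) (hode s)
      have hα : (1 / 2 + |(21 / 5 : ℝ)|) = 47 / 10 := by norm_num
      rw [hα] at h
      calc ‖iteratedDeriv 2 x s‖ ≤ |c s| * (47 / 10 * ‖x s‖ + M) := h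
        _ ≤ η * (47 / 10 * ‖x s‖ + M) := mul_le_mul_of_nonneg_right (hc s) (by positivity)
        _ ≤ _ := by
            refine mul_le_mul_of_nonneg_left ?_ hη
            nlinarith [hpos s, hs.le]
  have hin : ∀ t, |t| ≤ S₂ → ‖deriv x t - deriv x 0‖ ≤ η * ((47 / 10) * (‖x 0‖ + S₂) + M) * S₂ := by
    intro t ht
    have h := Convex.norm_image_sub_le_of_norm_deriv_le (f := deriv x) (fun v _ => hTd v)
      (fun v _ => by rw [← congrFun h2 v]; exact hcurv v) convex_univ (mem_univ 0) (mem_univ t)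
    rw [sub_zero, Real.norm_eq_abs] at h
    exact h.trans (mul_le_mul_of_nonneg_left ht hM₂0)
  have hout : ∀ t, S₂ ≤ |t| → ∃ t₀, |t₀| ≤ S₂ ∧ deriv x t = deriv x t₀ := by
    intro t ht
    rcases le_or_gt 0 t with ht0 | ht0
    · rw [abs_of_nonneg ht0] at ht
      refine ⟨S₂, by rw [abs_of_pos hS₂], ?_⟩
      have h := Convex.norm_image_sub_le_of_norm_deriv_le (f := deriv x) (s := Ici S₂) (C := 0)
        (fun v _ => hTd v) (fun v hv => by
          rw [← congrFun h2 v, harm v (by rw [abs_of_nonneg (hS₂.le.trans hv)]; exact hv), norm_zero])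
        (convex_Ici _) (mem_Ici.2 le_rfl) (mem_Ici.2 ht)
      rw [zero_mul, norm_le_zero_iff, sub_eq_zero] at h
      exact h
    · rw [abs_of_neg ht0] at ht
      refine ⟨-S₂, by rw [abs_neg, abs_of_pos hS₂], ?_⟩
      have h := Convex.norm_image_sub_le_of_norm_deriv_le (f := deriv x) (s := Iic (-S₂)) (C := 0)
        (fun v _ => hTd v) (fun v hv => by
          have hv' : S₂ ≤ |v| := by
            have hvle := mem_Iic.1 hv
            rw [abs_of_nonpos (by linarith)]; linarith
          rw [← congrFun h2 v, harm v hv', norm_zero])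
        (convex_Iic _) (mem_Iic.2 le_rfl) (mem_Iic.2 (by linarith [ht] : t ≤ -S₂))
      rw [zero_mul, norm_le_zero_iff, sub_eq_zero] at h
      exact h
  refine ⟨harm, hcurv, fun t => ?_⟩
  rcases le_or_gt |t| S₂ with ht | ht
  · exact hin t ht
  · obtain ⟨t₀, ht₀, heq⟩ := hout t ht.le
    rw [heq]; exact hin t₀ ht₀

/-! ### Size of the true-partner forcing -/

/-- **The true partner forcing is bounded by `(17/10)√Γ`** along a near-straight `R_π`-pair (`θ ≤ 1/500`): the frozen
rung-0 forcing has `‖U t‖ ≤ (8/5)√Γ` and the true field is within `28θ√Γ ≤ (7/125)√Γ` of it. [folklore] -/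
theorem partnerForcing_norm_le {Γ θ : ℝ} (hΓ : 0 < Γ) (hθ0 : 0 ≤ θ) (hθ1 : θ ≤ 1 / 500)
    {z : ℝ → EuclideanSpace ℝ (Fin 3)} (hz : ContDiff ℝ 1 z) (hunit : ∀ u, ‖deriv z u‖ = 1)
    (hz0 : z 0 = WithLp.toLp 2 ![Real.sqrt Γ / 5, 0, 0])
    (hθ : ∀ s, ‖deriv z s - WithLp.toLp 2 ![0, (Real.sqrt 2)⁻¹, (Real.sqrt 2)⁻¹]‖ ≤ θ) (t : ℝ) :
    ‖(Γ * 4 / (4 * Real.pi)) • (∫ σ : ℝ,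
        ((‖z t - ((2 * ⟪z σ, EuclideanSpace.single 2 1⟫_ℝ) • (EuclideanSpace.single (2 : Fin 3) (1 : ℝ)) - z σ)‖ ^ 2
            + 1) ^ (3 / 2 : ℝ))⁻¹ •
          cross (deriv (fun u => (2 * ⟪z u, EuclideanSpace.single 2 1⟫_ℝ) •
              (EuclideanSpace.single (2 : Fin 3) (1 : ℝ)) - z u) σ)
            (z t - ((2 * ⟪z σ, EuclideanSpace.single 2 1⟫_ℝ) • (EuclideanSpace.single (2 : Fin 3) (1 : ℝ)) - z σ)))‖
      ≤ 17 / 10 * Real.sqrt Γ := by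
  have hG : 0 < Real.sqrt Γ := Real.sqrt_pos.2 hΓ
  -- the frozen forcing, as an explicit function
  set U : ℝ → EuclideanSpace ℝ (Fin 3) := fun t => (2 * Γ / Real.pi / (4 * Γ / 25 + 1 + t ^ 2)) •
      ((2 * Real.sqrt Γ / 5) • (WithLp.toLp 2 ![0, (Real.sqrt 2)⁻¹, (Real.sqrt 2)⁻¹] : EuclideanSpace ℝ (Fin 3)) -
        t • WithLp.toLp 2 ![(1:ℝ), 0, 0]) with hUdef
  have hU : ∀ t, U t = (2 * Γ / Real.pi / (4 * Γ / 25 + 1 + t ^ 2)) •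
      ((2 * Real.sqrt Γ / 5) • (WithLp.toLp 2 ![0, (Real.sqrt 2)⁻¹, (Real.sqrt 2)⁻¹] : EuclideanSpace ℝ (Fin 3)) -
        t • WithLp.toLp 2 ![(1:ℝ), 0, 0]) := fun t => rfl
  have h1 := partnerField_sub_U_le hΓ hθ0 hθ1 U hU hz hunit hz0 hθ t
  have h2 := norm_U_le hΓ U hU t
  have h3 : ∀ a b : EuclideanSpace ℝ (Fin 3), ‖a‖ ≤ ‖b‖ + ‖a - b‖ := fun a b => by
    have := norm_add_le b (a - b); rwa [add_sub_cancel] at this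
  have h4 := h3 ((Γ * 4 / (4 * Real.pi)) • (∫ σ : ℝ,
        ((‖z t - ((2 * ⟪z σ, EuclideanSpace.single 2 1⟫_ℝ) • (EuclideanSpace.single (2 : Fin 3) (1 : ℝ)) - z σ)‖ ^ 2
            + 1) ^ (3 / 2 : ℝ))⁻¹ •
          cross (deriv (fun u => (2 * ⟪z u, EuclideanSpace.single 2 1⟫_ℝ) •
              (EuclideanSpace.single (2 : Fin 3) (1 : ℝ)) - z u) σ)
            (z t - ((2 * ⟪z σ, EuclideanSpace.single 2 1⟫_ℝ) • (EuclideanSpace.single (2 : Fin 3) (1 : ℝ)) - z σ))))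
    (U t)
  nlinarith [h1, h2, h4, mul_nonneg hθ0 hG.le]

end SelectionBoxRJRung

end Summit.NavierStokesRegularity.NavierStokesRegularity.Theorems
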